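import Mathlib
import Literature.NumberTheory.Transcendental.KZCalculus
import HarnessLib

/-!
# Stub `stub_sigmaChart` — crux `TorsionLogs.NeronTorsionSector`, line `registered` (block V4)

Chain-rule / monotonicity package in the compactifying chart `s = x^{-1/2}` (`x = s⁻²`,
`s ∈ (0, s₁]`, `s₁ = x₁^{-1/2}`) at the point at infinity of the real curve `y² = f(x)`.
With `R(s) = s³√f(s⁻²) > 0` on `[0, s₁]`:

* `τ̂ s = τ(s⁻²)` (chart conjugate of the lower translation `τ`, strictly increasing on `[x₁, ∞)`
  with `τ((x₁, ∞)) = (x₂, x₁)`): `HasDerivAt τ̂ (τ′(s⁻²)·(−2/s³)) s` on `(0, s₁)` (chain rule), the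
  chart Haar identity `|τ̂′|·R = 2√f∘τ̂`, `τ̂ s ∈ (x₂, x₁)`, strict anti-monotonicity on `(0, s₁]`,
  injectivity and `τ̂((0, s₁)) = (x₂, x₁)`;
* `σ s = (τ⁺(s⁻²))^{-1/2}` (chart image of the upper translation `τ⁺ : (x₁, ∞) → (x₁, ∞)`):
  `σ s ∈ (0, s₁)`, differentiability on `(0, s₁)` with `σ′ ≠ 0` and `|σ′|·R = R∘σ`, strict
  anti-monotonicity on `[0, s₁]` (continuous + injective by Rolle, `σ 0 = s₁`, `σ s₁ = 0`),
  injectivity and `σ((0, s₁)) = (0, s₁)` (IVT).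

Pure Mathlib calculus (`HasDerivAt.comp`, `HasDerivAt.inv`, `HasDerivAt.sqrt`,
`HasDerivAt.congr_of_eventuallyEq`, Rolle `exists_deriv_eq_zero`, IVT `intermediate_value_Icc'`,
`ContinuousOn.strictAntiOn_of_injOn_Icc`).

References: M. Kontsevich, D. Zagier, *Periods* (2001), §1.2 (rule (2), change of variables).
-/

noncomputable section

-- `Summit.KontsevichZagierPeriods.KontsevichZagierPeriods.…` is the tree's mandated layout (single-conjunct summit).
set_option linter.dupNamespace false

open Set Filter Topology

namespace Summit.KontsevichZagierPeriods.KontsevichZagierPeriods.Cruxes.NeronTorsionSector.Translation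

/-- The chart map `s ↦ (s²)⁻¹ = x` has derivative `−2/s³` at `s ≠ 0`.
[cite: KontsevichZagier2001, §1.2] -/
theorem sigmaChart_hasDerivAt_inv_sq {s : ℝ} (hs : s ≠ 0) :
    HasDerivAt (fun t : ℝ => (t ^ 2)⁻¹) (-2 / s ^ 3) s := by
  have h : HasDerivAt (fun t : ℝ => (t ^ 2)⁻¹) (-(((2 : ℕ) : ℝ) * s ^ (2 - 1)) / (s ^ 2) ^ 2) s :=
    (hasDerivAt_pow 2 s).inv (pow_ne_zero 2 hs)
  refine h.congr_deriv ?_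
  push_cast
  field_simp

/-- In the chart `x = (s²)⁻¹` with `s₁² x₁ = 1`: `0 < s ≤ s₁` gives `x₁ ≤ (s²)⁻¹`.
[cite: KontsevichZagier2001, §1.2] -/
theorem sigmaChart_le_inv_sq {x₁ s₁ s : ℝ} (hs1x : s₁ ^ 2 * x₁ = 1) (hs : 0 < s) (hss : s ≤ s₁) :
    x₁ ≤ (s ^ 2)⁻¹ := by
  rw [eq_inv_of_mul_eq_one_right hs1x]
  exact inv_anti₀ (by positivity) (pow_le_pow_left₀ hs.le hss 2)

/-- In the chart `x = (s²)⁻¹` with `s₁² x₁ = 1`: `0 < s < s₁` gives `x₁ < (s²)⁻¹`.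
[cite: KontsevichZagier2001, §1.2] -/
theorem sigmaChart_lt_inv_sq {x₁ s₁ s : ℝ} (hs1x : s₁ ^ 2 * x₁ = 1) (hs : 0 < s) (hss : s < s₁) :
    x₁ < (s ^ 2)⁻¹ := by
  rw [eq_inv_of_mul_eq_one_right hs1x]
  exact inv_strictAnti₀ (by positivity) (pow_lt_pow_left₀ hss hs.le two_ne_zero)

/-- **STUB V4 (`stub_sigmaChart`; chain rule in the chart `s = x^{-1/2}` at infinity).** With
`R(s) = s³√f(s⁻²)` (`> 0` on `[0, s₁]`, `s₁ = x₁^{-1/2}`), the chart conjugates `τ̂ = τ(s⁻²)` of the lower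
translation on `[x₁, ∞)` and `σ = (τ⁺(s⁻²))^{-1/2}` of the upper translation on `(x₁, ∞)` (which maps
`(x₁, ∞)` into itself) are differentiable on `(0, s₁)` with the chart Haar identities `|τ̂′|·R = 2√f∘τ̂`,
`|σ′|·R = R∘σ`, non-vanishing derivatives; `τ̂` is strictly decreasing with `τ̂((0,s₁)) = (x₂, x₁)`; `σ` is a
strictly decreasing bijection of `[0, s₁]` (injective by Rolle, `σ(0) = s₁`, `σ(s₁) = 0`, continuity) with
`σ((0,s₁)) = (0,s₁)`. [cite: KontsevichZagier2001, §1.2 rule (2)] -/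
theorem stub_sigmaChart :
    ∀ (x₁ x₂ s₁ : ℝ) (f τ τ' τp τp' R τh τhp σ : ℝ → ℝ),
    0 < x₁ → 0 < s₁ → s₁ ^ 2 * x₁ = 1 → x₂ < x₁ →
    (∀ x, x₁ ≤ x → 0 < f x) →
    (∀ s, 0 < s → s ≤ s₁ → Real.sqrt (f (s ^ 2)⁻¹) = R s / s ^ 3) →
    (∀ s ∈ Set.Icc 0 s₁, 0 < R s) →
    (∀ x, x₁ ≤ x → HasDerivAt τ (τ' x) x ∧ τ' x ≠ 0 ∧ |τ' x| * Real.sqrt (f x) = Real.sqrt (f (τ x))) →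
    StrictMonoOn τ (Set.Ici x₁) → τ '' Set.Ioi x₁ = Set.Ioo x₂ x₁ →
    (∀ s, 0 < s → s ≤ s₁ → τh s = τ (s ^ 2)⁻¹) → τh 0 = x₁ →
    (∀ x, x₁ < x → HasDerivAt τp (τp' x) x ∧ τp' x ≠ 0 ∧
      |τp' x| * Real.sqrt (f x) = Real.sqrt (f (τp x)) ∧ x₁ < τp x) →
    (∀ s, 0 < s → s < s₁ → τhp s = τp (s ^ 2)⁻¹ ∧ σ s ^ 2 * τhp s = 1 ∧ 0 < σ s) →
    σ 0 = s₁ → σ s₁ = 0 → ContinuousOn σ (Set.Icc 0 s₁) →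
    (∀ s ∈ Set.Ioo 0 s₁, HasDerivAt τh (τ' (s ^ 2)⁻¹ * (-2 / s ^ 3)) s ∧ τ' (s ^ 2)⁻¹ * (-2 / s ^ 3) ≠ 0 ∧
      |τ' (s ^ 2)⁻¹ * (-2 / s ^ 3)| * R s = 2 * Real.sqrt (f (τh s)) ∧ τh s ∈ Set.Ioo x₂ x₁) ∧
    StrictAntiOn τh (Set.Ioc 0 s₁) ∧ Set.InjOn τh (Set.Ioo 0 s₁) ∧ τh '' Set.Ioo 0 s₁ = Set.Ioo x₂ x₁ ∧
    (∀ s ∈ Set.Ioo 0 s₁, σ s ∈ Set.Ioo 0 s₁ ∧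
      ∃ σ' : ℝ, HasDerivAt σ σ' s ∧ σ' ≠ 0 ∧ |σ'| * R s = R (σ s)) ∧
    StrictAntiOn σ (Set.Icc 0 s₁) ∧ Set.InjOn σ (Set.Ioo 0 s₁) ∧ σ '' Set.Ioo 0 s₁ = Set.Ioo 0 s₁ := by
  intro x₁ x₂ s₁ f τ τ' τp τp' R τh τhp σ hx1 hs1 hs1x hx21 _hfpos hsqrtR _hRpos hτ hτmono hτimg hτh _hτh0
    hτp hσ hσ0 hσs1 hσcont
  -- `R s = √f(s⁻²)·s³` on `0 < s ≤ s₁`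
  have hRs : ∀ s, 0 < s → s ≤ s₁ → R s = Real.sqrt (f (s ^ 2)⁻¹) * s ^ 3 := fun s hs hss =>
    ((eq_div_iff (pow_ne_zero 3 hs.ne')).1 (hsqrtR s hs hss)).symm
  -- ### Part A: the lower chart conjugate `τ̂` on `(0, s₁)`
  have hA : ∀ s ∈ Set.Ioo 0 s₁, HasDerivAt τh (τ' (s ^ 2)⁻¹ * (-2 / s ^ 3)) s ∧
      τ' (s ^ 2)⁻¹ * (-2 / s ^ 3) ≠ 0 ∧
      |τ' (s ^ 2)⁻¹ * (-2 / s ^ 3)| * R s = 2 * Real.sqrt (f (τh s)) ∧ τh s ∈ Set.Ioo x₂ x₁ := by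
    intro s hs
    obtain ⟨hs0, hss1⟩ := hs
    have hxgt : x₁ < (s ^ 2)⁻¹ := sigmaChart_lt_inv_sq hs1x hs0 hss1
    obtain ⟨hdτ, hτ'ne, hhaar⟩ := hτ _ hxgt.le
    have hg := sigmaChart_hasDerivAt_inv_sq hs0.ne'
    have hcomp : HasDerivAt (τ ∘ fun t : ℝ => (t ^ 2)⁻¹) (τ' (s ^ 2)⁻¹ * (-2 / s ^ 3)) s :=
      hdτ.comp s hg
    have heq : τh =ᶠ[𝓝 s] (τ ∘ fun t : ℝ => (t ^ 2)⁻¹) :=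
      Filter.eventuallyEq_of_mem (Ioo_mem_nhds hs0 hss1) fun t ht => by
        show τh t = τ (t ^ 2)⁻¹
        exact hτh t ht.1 ht.2.le
    refine ⟨hcomp.congr_of_eventuallyEq heq, ?_, ?_, ?_⟩
    · exact mul_ne_zero hτ'ne (div_ne_zero (by norm_num) (pow_ne_zero 3 hs0.ne'))
    · rw [hτh s hs0 hss1.le, ← hhaar, hRs s hs0 hss1.le, abs_mul, abs_div, abs_neg, abs_two,
        abs_of_pos (pow_pos hs0 3)]
      field_simp
    · rw [hτh s hs0 hss1.le, ← hτimg]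
      exact Set.mem_image_of_mem τ hxgt
  -- ### Part B: strict anti-monotonicity of `τ̂` on `(0, s₁]`
  have hB : StrictAntiOn τh (Set.Ioc 0 s₁) := by
    intro a ha b hb hab
    rw [hτh a ha.1 ha.2, hτh b hb.1 hb.2]
    exact hτmono (sigmaChart_le_inv_sq hs1x hb.1 hb.2) (sigmaChart_le_inv_sq hs1x ha.1 ha.2)
      (inv_strictAnti₀ (pow_pos ha.1 2) (pow_lt_pow_left₀ hab ha.1.le two_ne_zero))
  -- ### Part D: the image `τ̂((0, s₁)) = (x₂, x₁)`
  have hD : τh '' Set.Ioo 0 s₁ = Set.Ioo x₂ x₁ := by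
    apply Set.Subset.antisymm
    · rintro _ ⟨s, hs, rfl⟩
      exact (hA s hs).2.2.2
    · intro y hy
      rw [← hτimg] at hy
      obtain ⟨x, hx, rfl⟩ := hy
      have hx0 : 0 < x := hx1.trans hx
      have hsx : ((Real.sqrt x)⁻¹ ^ 2)⁻¹ = x := by
        rw [inv_pow, inv_inv, Real.sq_sqrt hx0.le]
      have hspos : 0 < (Real.sqrt x)⁻¹ := inv_pos.2 (Real.sqrt_pos.2 hx0)
      have hslt : (Real.sqrt x)⁻¹ < s₁ := by
        refine lt_of_pow_lt_pow_left₀ 2 hs1.le ?_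
        rw [inv_pow, Real.sq_sqrt hx0.le, eq_inv_of_mul_eq_one_left hs1x]
        exact inv_strictAnti₀ hx1 hx
      refine ⟨(Real.sqrt x)⁻¹, ⟨hspos, hslt⟩, ?_⟩
      rw [hτh _ hspos hslt.le, hsx]
  -- ### Part E: the upper chart conjugate `σ` on `(0, s₁)`
  have hE : ∀ s ∈ Set.Ioo 0 s₁, σ s ∈ Set.Ioo 0 s₁ ∧
      ∃ σ' : ℝ, HasDerivAt σ σ' s ∧ σ' ≠ 0 ∧ |σ'| * R s = R (σ s) := by
    intro s hs
    obtain ⟨hs0, hss1⟩ := hs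
    have hxgt : x₁ < (s ^ 2)⁻¹ := sigmaChart_lt_inv_sq hs1x hs0 hss1
    obtain ⟨hτhps, hσ2, hσpos⟩ := hσ s hs0 hss1
    obtain ⟨hdτp, hτp'ne, hhaarp, hTgt⟩ := hτp _ hxgt
    have hTpos : 0 < τp (s ^ 2)⁻¹ := hx1.trans hTgt
    -- `τ⁺(s⁻²) = (σ s)⁻²`, `√(τ⁺(s⁻²)) = (σ s)⁻¹`
    have hT : τp (s ^ 2)⁻¹ = (σ s ^ 2)⁻¹ := by
      rw [← hτhps]
      exact eq_inv_of_mul_eq_one_right hσ2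
    have hsqT : Real.sqrt (τp (s ^ 2)⁻¹) = (σ s)⁻¹ := by
      rw [hT, Real.sqrt_inv, Real.sqrt_sq hσpos.le]
    -- `σ s < s₁`
    have hσlt : σ s < s₁ := by
      refine lt_of_pow_lt_pow_left₀ 2 hs1.le ?_
      rw [eq_inv_of_mul_eq_one_left hs1x, ← inv_inv (σ s ^ 2), ← hT]
      exact inv_strictAnti₀ hx1 hTgt
    refine ⟨⟨hσpos, hσlt⟩, τp' (s ^ 2)⁻¹ * σ s ^ 3 / s ^ 3, ?_, ?_, ?_⟩
    · -- the chain rule: `σ = (√(τ⁺ ∘ (·)⁻²))⁻¹` near `s`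
      have hg := sigmaChart_hasDerivAt_inv_sq hs0.ne'
      have h1 : HasDerivAt (τp ∘ fun t : ℝ => (t ^ 2)⁻¹) (τp' (s ^ 2)⁻¹ * (-2 / s ^ 3)) s :=
        hdτp.comp s hg
      have h2 := h1.sqrt hTpos.ne'
      have h3 := h2.inv ((Real.sqrt_pos.2 hTpos).ne')
      have heq : σ =ᶠ[𝓝 s] (fun y => Real.sqrt ((τp ∘ fun t : ℝ => (t ^ 2)⁻¹) y))⁻¹ := by
        refine Filter.eventuallyEq_of_mem (Ioo_mem_nhds hs0 hss1) fun t ht => ?_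
        obtain ⟨hτhpt, hσ2t, hσpost⟩ := hσ t ht.1 ht.2
        have hTt : τp (t ^ 2)⁻¹ = (σ t ^ 2)⁻¹ := by
          rw [← hτhpt]
          exact eq_inv_of_mul_eq_one_right hσ2t
        show σ t = (Real.sqrt (τp (t ^ 2)⁻¹))⁻¹
        rw [hTt, Real.sqrt_inv, Real.sqrt_sq hσpost.le, inv_inv]
      refine (h3.congr_of_eventuallyEq heq).congr_deriv ?_
      show -(τp' (s ^ 2)⁻¹ * (-2 / s ^ 3) / (2 * Real.sqrt (τp (s ^ 2)⁻¹))) /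
          Real.sqrt (τp (s ^ 2)⁻¹) ^ 2 = τp' (s ^ 2)⁻¹ * σ s ^ 3 / s ^ 3
      rw [hsqT]
      field_simp
    · exact div_ne_zero (mul_ne_zero hτp'ne (pow_ne_zero 3 hσpos.ne')) (pow_ne_zero 3 hs0.ne')
    · -- the chart Haar identity `|σ′|·R = R∘σ`
      have hRu : R (σ s) = Real.sqrt (f (τp (s ^ 2)⁻¹)) * σ s ^ 3 := by
        have h := hRs (σ s) hσpos hσlt.le
        rwa [← hT] at h
      rw [hRu, hRs s hs0 hss1.le, ← hhaarp, abs_div, abs_mul, abs_of_pos (pow_pos hσpos 3),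
        abs_of_pos (pow_pos hs0 3)]
      field_simp
  -- ### Part F: strict anti-monotonicity of `σ` on `[0, s₁]` (Rolle + continuity)
  have hinj : Set.InjOn σ (Set.Icc 0 s₁) := by
    intro a ha b hb hab
    by_contra hne
    rcases lt_or_gt_of_ne hne with h | h
    · obtain ⟨c, hc, hc0⟩ :=
        exists_deriv_eq_zero h (hσcont.mono (Set.Icc_subset_Icc ha.1 hb.2)) hab
      obtain ⟨_, σ', hd, hne', _⟩ := hE c ⟨ha.1.trans_lt hc.1, hc.2.trans_le hb.2⟩
      exact hne' (hd.deriv ▸ hc0)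
    · obtain ⟨c, hc, hc0⟩ :=
        exists_deriv_eq_zero h (hσcont.mono (Set.Icc_subset_Icc hb.1 ha.2)) hab.symm
      obtain ⟨_, σ', hd, hne', _⟩ := hE c ⟨hb.1.trans_lt hc.1, hc.2.trans_le ha.2⟩
      exact hne' (hd.deriv ▸ hc0)
  have hF : StrictAntiOn σ (Set.Icc 0 s₁) :=
    hσcont.strictAntiOn_of_injOn_Icc hs1.le (by rw [hσ0, hσs1]; exact hs1.le) hinj
  -- ### Part H: the image `σ((0, s₁)) = (0, s₁)` (IVT)
  have hH : σ '' Set.Ioo 0 s₁ = Set.Ioo 0 s₁ := by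
    apply Set.Subset.antisymm
    · rintro _ ⟨s, hs, rfl⟩
      exact (hE s hs).1
    · intro y hy
      have hIVT := intermediate_value_Icc' hs1.le hσcont
      rw [hσ0, hσs1] at hIVT
      obtain ⟨c, hc, hcy⟩ := hIVT (Set.Ioo_subset_Icc_self hy)
      refine ⟨c, ⟨?_, ?_⟩, hcy⟩
      · rcases hc.1.eq_or_lt with h | h
        · rw [← h, hσ0] at hcy
          exact absurd hcy hy.2.ne'
        · exact h
      · rcases hc.2.eq_or_lt with h | h
        · rw [h, hσs1] at hcy
          exact absurd hcy hy.1.ne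
        · exact h
  exact ⟨hA, hB, hB.injOn.mono Set.Ioo_subset_Ioc_self, hD, hE, hF,
    hF.injOn.mono Set.Ioo_subset_Icc_self, hH⟩

end Summit.KontsevichZagierPeriods.KontsevichZagierPeriods.Cruxes.NeronTorsionSector.Translation
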